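import Summits.Ventures.PackingBounds.ThreePointCert.CheckSym2

/-!
# Three-point certificate checker, mode `sym2`: the check of `(ii')` split into three kernel steps

Framing: lottery ticket; floor = certified bounds/negative ranges. Venture `PackingBounds`
(cell `pub-packcert`), three-point SDP family.

`ThreePointCert.CheckSym2.checkII3S2` bounds the residual of identity `(ii')` (Bachoc–Vallentin
multiplier set) in ONE trie-based `residualBound` over all terms of
`target − E₀ − [g_q E₁ coset sum] − m₂E₂ − m₃E₃ − s₄E₄ − c₀`. The number of terms pushed through the
trie grows with the degree (≈ 1.2·10⁵ at n = 7, d = 12, which already exceeds the kernel's memory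
bound on the smaller farm nodes; ≈ 2·10⁵ at n = 5, d = 14). This file splits the same check into
three `decide`s of bounded size, with two intermediate polynomials `M`, `M'` supplied as data by
the emitter:

* `checkII3S2a`: `target − E₀ − g_qE₁ − (g_qE₁)(v,u,t) − (g_qE₁)(t,v,u) − M ≡ 0` (residual `0`),
* `checkII3S2b`: `M − m₂E₂ − M' ≡ 0` (residual `0`),
* `checkII3S2c`: `|M' − m₃E₃ − s₄E₄ − c₀| ≤ c₀` on the unit box (the slack step).

Soundness (`FII3S2_of_checkSplit`, `card_le_of_cert3S2split`) is the soundness of `checkII3S2`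
with the three residual bounds added up: on the box, `target = E₀ + cosets + M`,
`M = m₂E₂ + M'` and `M' ≥ m₃E₃ + s₄E₄`, so `target ≥ rhsII3S2 ≥ 0` (`rhsII3S2_nonneg`). Whatever
`M`, `M'` are, a passing triple of checks is sound; the data format `Cert3`/`CertPolys3`,
`PolysOK3`, `checkI3`, `checkSide3`, `checkBound3` and the final statement are unchanged.

## References
* C. Bachoc, F. Vallentin, New upper bounds for kissing numbers from semidefinite programming,
  J. Amer. Math. Soc. 21 (2008) 909–924, Theorem 4.2 and (10). [`BachocVallentin2007`]
-/

noncomputable section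

open Finset
open scoped RealInnerProductSpace

namespace Summit.Ventures.PackingBounds.ThreePointCert

open Literature.Geometry.DiscreteGeometry Literature.Geometry.DiscreteGeometry.PolyCert
open Literature.Geometry.DiscreteGeometry.PolyCert.SPoly
open Literature.Analysis.SpecialFunctions

/-- Step (a) of the split check of `(ii')` (mode `sym2`): the exact identity
`target − E₀ − g_qE₁ − (g_qE₁)(v,u,t) − (g_qE₁)(t,v,u) − M ≡ 0` for the intermediate polynomial `M`. -/
def checkII3S2a (c : Cert3) (P : CertPolys3) (M : SPoly) : Bool :=
  residualBound (mergeAll [targetII3 c P, neg P.E0, neg (gE1 c P), neg (permBAC (gE1 c P)),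
    neg (permCBA (gE1 c P)), neg M]) 0

/-- Step (b): the exact identity `M − m₂E₂ − M' ≡ 0`. -/
def checkII3S2b (c : Cert3) (P : CertPolys3) (M M' : SPoly) : Bool :=
  residualBound (mergeAll [M, neg (mulN (m2P c.p c.q) P.E2), neg M']) 0

/-- Step (c): `|M' − m₃E₃ − s₄E₄ − c₀| ≤ c₀` on the unit box (the slack of `(ii')`). -/
def checkII3S2c (c : Cert3) (P : CertPolys3) (M' : SPoly) : Bool :=
  residualBound (mergeAll [M', neg (mulN (m3P c.p c.q) P.E3), neg (mulN p4 P.E4),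
    neg (C (c.c0 : ℤ))]) c.c0

set_option maxHeartbeats 4000000 in
/-- Soundness of `(ii')` in mode `sym2` from the three split checks: on `D'`, `F ≤ -b₂₂`
(in units: `FvalG/D² ≤ -B22/(D²W)`), for any intermediate polynomials `M`, `M'`. -/
theorem FII3S2_of_checkSplit (c : Cert3) (P : CertPolys3) {g0 g1 g2 g3 g4 q0 q1 : GramBlk}
    (hP : PolysOK3 c P g0 g1 g2 g3 g4 q0 q1) (M M' : SPoly) (ha : checkII3S2a c P M = true)
    (hb : checkII3S2b c P M M' = true) (hc : checkII3S2c c P M' = true)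
    (hs : checkSide3 c = true) (u v t : ℝ)
    (hu : -1 ≤ u) (hu' : u ≤ (c.p : ℝ) / c.q) (hv : -1 ≤ v) (hv' : v ≤ (c.p : ℝ) / c.q)
    (ht : -1 ≤ t) (ht' : t ≤ (c.p : ℝ) / c.q)
    (hp : 0 ≤ 1 + 2 * u * v * t - u ^ 2 - v ^ 2 - t ^ 2) :
    FvalG c.n c.F u v t / 2 ^ (2 * c.S) ≤ -((c.B22 : ℝ) / c.DDW) := by
  obtain ⟨hn, hq, hpq, _, hAlen, hFk, _⟩ := side_of_check c hs
  have hu1 := abs_le_one_of_box c.p c.q hq hpq u hu hu'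
  have hv1 := abs_le_one_of_box c.p c.q hq hpq v hv hv'
  have ht1 := abs_le_one_of_box c.p c.q hq hpq t ht ht'
  have ra := abs_eval_le_of_residualBound _ _ ha hu1 hv1 ht1
  have rb := abs_eval_le_of_residualBound _ _ hb hu1 hv1 ht1
  have rc := abs_eval_le_of_residualBound _ _ hc hu1 hv1 ht1
  rw [eval_mergeAll] at ra rb rc
  simp only [List.map_cons, List.map_nil, List.sum_cons, List.sum_nil, add_zero, eval_neg, eval_C,
    Int.cast_natCast, Nat.cast_zero] at ra rb rc
  have hrhs : 0 ≤ eval (rhsII3S2 c P) u v t :=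
    rhsII3S2_nonneg c P hP hq hpq u v t hu hu' hv hv' ht ht' hp
  rw [rhsII3S2, eval_mergeAll] at hrhs
  simp only [List.map_cons, List.map_nil, List.sum_cons, List.sum_nil, add_zero] at hrhs
  have htgt : 0 ≤ eval (targetII3 c P) u v t := by
    have a1 := (abs_le.1 ra).1
    have b1 := (abs_le.1 rb).1
    have b2 := (abs_le.1 rb).2
    have c1 := (abs_le.1 rc).1
    linarith
  rw [targetII3, eval_neg, eval_append, eval_C, hP.hF u v t hu1 hv1 ht1,
    eval_FPolyG c.n c.d c.F hFk] at htgt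
  push_cast at htgt
  have hW : (0 : ℝ) < Wfac c.d := by exact_mod_cast Wfac_pos c.d
  have hD : (0 : ℝ) < 2 ^ (2 * c.S) := pow_pos (by norm_num) _
  have hDDW : (c.DDW : ℝ) = 2 ^ (2 * c.S) * (Wfac c.d : ℝ) := by simp [Cert3.DDW]
  have key : FvalG c.n c.F u v t * (Wfac c.d : ℝ) ≤ -(c.B22 : ℝ) := by linarith
  rw [hDDW, div_le_iff₀ hD]
  have e : -((c.B22 : ℝ) / (2 ^ (2 * c.S) * Wfac c.d)) * 2 ^ (2 * c.S) = -(c.B22 : ℝ) / Wfac c.d := by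
    field_simp
  rw [e, le_div_iff₀ hW]
  exact key

/-- **The bound from a checked certificate in Bachoc–Vallentin's own multiplier set** (mode
`sym2`) with the check of `(ii')` done in the three steps `checkII3S2a/b/c` (intermediate
polynomials `M`, `M'` supplied as data); otherwise exactly `card_le_of_cert3S2`: every finite set
of unit vectors of `ℝⁿ` (`n = c.n ≥ 4`) with pairwise inner products `≤ c.p/c.q` has at most `c.N`
elements. -/
theorem card_le_of_cert3S2split (c : Cert3) (P : CertPolys3) {g0 g1 g2 g3 g4 q0 q1 : GramBlk}
    (hP : PolysOK3 c P g0 g1 g2 g3 g4 q0 q1) (hI : checkI3 c P = true) (M M' : SPoly)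
    (ha : checkII3S2a c P M = true) (hb : checkII3S2b c P M M' = true)
    (hc : checkII3S2c c P M' = true) (hs : checkSide3 c = true) (hb3 : checkBound3 c P = true)
    (C : Finset (EuclideanSpace ℝ (Fin c.n))) (hC : ∀ x ∈ C, ‖x‖ = 1)
    (hcode : ∀ x ∈ C, ∀ y ∈ C, x ≠ y → inner ℝ x y ≤ (c.p : ℝ) / c.q) : C.card ≤ c.N := by
  obtain ⟨hn, hq, hpq, _, hAlen, hFk, _⟩ := side_of_check c hs
  have hbd := bound3_of_check c P hP.hF hs hb3
  have hD : (0 : ℝ) < 2 ^ (2 * c.S) := pow_pos (by norm_num) _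
  have hA : 0 ≤ BachocVallentin.pairSum C (fun u => AvalG c.n c.A u / 2 ^ (2 * c.S)) := by
    have h0 := pairSum_AvalG_nonneg (by omega : 3 ≤ c.n) c.A C hC
    unfold BachocVallentin.pairSum at h0 ⊢
    have e : (∑ x ∈ C, ∑ y ∈ C, AvalG c.n c.A (inner ℝ x y) / 2 ^ (2 * c.S)) =
        (∑ x ∈ C, ∑ y ∈ C, AvalG c.n c.A (inner ℝ x y)) / 2 ^ (2 * c.S) := by
      rw [Finset.sum_div]; refine Finset.sum_congr rfl fun x _ => ?_; rw [Finset.sum_div]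
    rw [e]; exact div_nonneg h0 hD.le
  have hF : 0 ≤ BachocVallentin.tripleSum C (fun u v t => FvalG c.n c.F u v t / 2 ^ (2 * c.S)) := by
    have h0 := tripleSum_FvalG_nonneg hn c.F C hC
    unfold BachocVallentin.tripleSum at h0 ⊢
    have e : (∑ x ∈ C, ∑ y ∈ C, ∑ z ∈ C,
        FvalG c.n c.F (inner ℝ x y) (inner ℝ x z) (inner ℝ y z) / 2 ^ (2 * c.S))
        = (∑ x ∈ C, ∑ y ∈ C, ∑ z ∈ C,
          FvalG c.n c.F (inner ℝ x y) (inner ℝ x z) (inner ℝ y z)) / 2 ^ (2 * c.S) := by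
      rw [Finset.sum_div]; refine Finset.sum_congr rfl fun x _ => ?_
      rw [Finset.sum_div]; refine Finset.sum_congr rfl fun y _ => ?_
      rw [Finset.sum_div]
    rw [e]; exact div_nonneg h0 hD.le
  have h := BachocVallentin.card_le_of_threePoint ((c.p : ℝ) / c.q) C hC hcode
    (fun u => AvalG c.n c.A u / 2 ^ (2 * c.S)) (fun u v t => FvalG c.n c.F u v t / 2 ^ (2 * c.S))
    ((c.B11 : ℝ) / c.DDW) ((c.B12 : ℝ) / c.DDW) ((c.B22 : ℝ) / c.DDW) hA hF
    (fun u v t => by rw [FvalG_swap12])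
    (fun u v t => by rw [FvalG_swap23])
    (bquad3_nonneg_of_check c hs)
    (fun u hu hu' => AF3_of_check c P hP hI hs u hu hu')
    (fun u v t hu hu' hv hv' ht ht' hp =>
      FII3S2_of_checkSplit c P hP M M' ha hb hc hs u v t hu hu' hv hv' ht ht' hp)
    hbd.2
  have hlt : (C.card : ℝ) < (c.N : ℝ) + 1 := lt_of_le_of_lt h hbd.1
  have hlt' : C.card < c.N + 1 := by exact_mod_cast hlt
  omega

end Summit.Ventures.PackingBounds.ThreePointCert

end
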